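import Summits.BirchSwinnertonDyer.BirchSwinnertonDyer.Theorems.ManinLocalTwoThreeShimuraIndexMuThree
import Summits.BirchSwinnertonDyer.BirchSwinnertonDyer.Theorems.ManinLocalTwoThreeShimuraQuotientRational
import Summits.BirchSwinnertonDyer.BirchSwinnertonDyer.Theorems.ManinLocalTwoThreeUDCLineKAtNine
import Summits.BirchSwinnertonDyer.Rank1Residual.ManinAdditive.ShimuraCuspAnnihilator
import Literature.NumberTheory.EllipticCurves.Gamma1ParametrizationCuspRationality
import Literature.NumberTheory.EllipticCurves.ModularParametrizationCuspZeroRationality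
import Literature.NumberTheory.EllipticCurves.ModularSymbolsManinDrinfeldProofs
import Literature.NumberTheory.EllipticCurves.ModularSymbolsLattice
import Literature.NumberTheory.EllipticCurves.ModularCurveManinSemistableBridgeProofs
import Literature.NumberTheory.EllipticCurves.TwoTorsionCardProofs
import HarnessLib

/-!
# es's ANNIHILATOR LAW Θ (E-es-80) — PROVED IN THE KERNEL from three PRINTED facts, on the optimal stratum;
# hence E-an-128 / 128ℓ / 128₄ / 128₂ (and, with an g40 FILE 1, E-an-221 = the last non-printed stub of C3 skeleton v33) ⟸ PRINT
(route `ManinLocalTwoThree`, crux C3 `ManinPrimeToThreeAtNine` stmt-BirchSwinnertonDyer-22968; cell bsd-f2-manin, lens `an`, planner an g41,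
MEMO-an §86; proposed Theorems target `…/Theorems/ManinLocalTwoThreeCuspZeroAnnihilatorOfCuspGalois.lean`, `--supports stmt-BirchSwinnertonDyer-22968`)

CONTENT.  es's `f`-level annihilator law **E-es-80** `KatoCurve.CuspZeroAnnihilatesShimuraQuotient` («`m·{∞,0}_f ∈ Λ₀(f)` ⟹ `m·Λ₀(f) ⊆ Λ₁(f)`»,
THEOREM Θ on paper, REF1 §R79 PASS; OPEN in Lean; the ONLY non-printed input left under the C3 net of an g40, MEMO-an §84) is PROVED here — on the
stratum the C3 net actually uses (a lattice-optimal `X₀(N)`-datum of a globally minimal `W`, §3) — from THREE PRINTED FACTS and tree theorems: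
  (F★)  `optimalGamma1Parametrization_cusp_rational` (tree, CES 2003 §6.1.2/§6.2): for an OPTIMAL `X₁(N)`-datum `D₁` of `W₁` and `γ ∈ Γ₀(N)`,
        `D₁.uniformize (c₁·{∞,γ∞}_f)` is the base change of a point of `W₁(ℚ)`;
  (F♮)  **NEW named fact, typer request T-an-53** `optimalGamma1Parametrization_cuspZero_galoisConjugate` (written below as the explicit hypothesis
        BINDER `hB`, verbatim the text handed to the typer for `Literature/NumberTheory/EllipticCurves/Gamma1ParametrizationCuspZeroGaloisOrbit.lean`):
        for an optimal `X₁(N)`-datum `D₁` of `W₁` and every `γ ∈ Γ₀(N)` there is a field automorphism `σ` of `ℂ` with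
        `σ(φ₁(0)) = φ₁(γ·0)`, i.e. `Point.map σ (D₁.uniformize (c₁·{∞,0}_f)) = D₁.uniformize (c₁·({∞,0}_f + {∞,γ∞}_f))`
        — Stevens 1982 Thm 1.3.1 (the cusps of `X₁(N)` are rational over `ℚ(ζ_N)`, `τ_d : [x;y] ↦ [x;d′y]`, so `Gal(ℚ(ζ_N)/ℚ)` permutes the
        `φ(N)/2` cusps `[0;y]` above the cusp `0` of `X₀(N)` TRANSITIVELY, and these are the `γ·0`, `γ ∈ Γ₀(N)`), transported through the `ℚ`-morphism
        `φ₁ : X₁(N) → E₁` (CES 2003 §6.1.2, as in F★) and evaluated by Manin's `{∞,γ0}_f = {∞,γ∞}_f + {∞,0}_f` (`modularSymbol_gamma0_smul_holds`);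
  (CES) `exists_optimal_gamma1ParametrizationData` (tree, CES 2003 Thm 1.1.3 / Stevens 1989 Thm 1.9): a lattice-optimal `X₀(N)`-datum of a minimal `W`
        has an ISOGENOUS curve `W₁` with an OPTIMAL `X₁(N)`-datum (same newform, §3);
  plus Manin–Drinfeld for rational newforms (`exists_nsmul_modularSymbol_mem_periodLattice_of_isNewform0`), `coe_periodLattice_eq_range`
  (every `Γ₀(N)`-period IS a cusp symbol), multiplicity one (`eq_of_forall_cuspCoeff_eq_gamma0`) and Mathlib's `Affine.Point.map_baseChange`
  (rational points are fixed by every `σ ∈ Aut(ℂ/ℚ)`).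

THE PROOF (§2, `periodLattice_mul_mem_periodLatticeGamma1_of_isOptimal`; = REF1 §R79 steps (i)–(iii), es MEMO §34).  Work on `E₁(ℂ) = ℂ/Λ_{E₁}`,
`Λ_{E₁} = c₁·Λ₁(f)` (optimality).  `Q₀ := φ₁(0) = D₁.uniformize (c₁{∞,0}_f)`.  If `m{∞,0}_f ∈ Λ₀(f)` then `m•Q₀ = D₁.uniformize (c₁·m{∞,0}_f)` is
RATIONAL (F★ + `coe_periodLattice_eq_range`), hence FIXED by `σ` (`map_baseChange`).  By F♮, `σ(Q₀) = Q₀ + D₁.uniformize (c₁{∞,γ∞}_f)`, so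
applying `σ` to `m•Q₀`: `m • D₁.uniformize (c₁{∞,γ∞}_f) = 0`, i.e. `c₁·m·{∞,γ∞}_f ∈ Λ_{E₁} = c₁Λ₁(f)`, i.e. `m{∞,γ∞}_f ∈ Λ₁(f)` (`c₁ ≠ 0`).  As
`{∞,γ∞}_f` runs through ALL of `Λ₀(f)`: `m·Λ₀(f) ⊆ Λ₁(f)`.  ∎  (No `q`-expansions, no Drinfeld–Manin splitting field, no `X₁(N)` scheme theory
inside Lean: the Galois theory is CONSUMED through F★/F♮ exactly as the tree already consumes F★.)

CONSEQUENCES (§3–§4, all PROVED, by name): `cuspZeroAnnihilates_of_latticeOptimal : F★ → F♮ → CES → (Θ on the optimal minimal stratum)`;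
`shimuraThreeForcesRationalThreeTorsion_of_cuspGalois : F★₀ → F★ → F♮ → CES → E-an-128` (F★₀ = tree `optimalParametrization_cuspZero_rational`,
p741081); likewise E-an-128ℓ (`shimuraOddPrimeForcesRationalTorsion_of_cuspGalois`), E-an-128₄ (`shimuraFourForcesRationalFourTorsion_of_cuspGalois`),
E-an-128₂ (`shimuraTwoForcesRationalTwoTorsion_of_cuspGalois`).  With an g40 FILE 1 (`shimuraThreeKernelForcesRationalThreeTorsionAtNine_of_cuspLifting :
E-an-128 → E-an-221`) the C3 LEAD's skeleton v33 stub `stub_shimuraThreeKernelForcesRationalThreeTorsionAtNine` (E-an-221) becomes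
⟸ F★₀ ∧ F★ ∧ F♮ ∧ CES — ALL PRINTED — and v33 = {F₃♮ (Kato 2004 Thm 17.4, printed), CDT-algInt (printed), E-an-221 (⟸ print)}: every stub of the
C3 skeleton is then a printed fact or a kernel theorem.

HONEST FRAMING.  F♮ is PRINTED (Stevens 1982 Thm 1.3.1 + CES 2003 §6.1 + Manin 1972 §1) but NOT YET a tree fact (T-an-53; this file carries its text as
the binder `hB`, so nothing here is conditional on an unlanded declaration).  (BI)_K, (AN♮)_K are LEAD's K-pieces (kernel theorems p740441 / p740759+p741124).
C3 = `9 ∣ N ⟹ 3 ∤ c₀` is NOT proved by this file; Manin's conjecture and BSD are NOT proved by this.  No definitions, no sorry, standard axioms.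
PARTITION 0 · beyond-print theorem: YES for Θ|opt ⟸ (F★, F♮, CES) and E-an-128/128ℓ/128₄/128₂ ⟸ print (kernel; not in print as stated: Stevens 1982
/ Vatsal 2005 Rem. 1.8 give «Shimura cover has constant kernel», i.e. `Λ₀/Λ₁ ⊂ E₁(ℚ)`, not the cusp-`0` ANNIHILATOR nor the `X₀`-optimal torsion
consequence at additive level) · BSD is not proved by this; Manin's conjecture is not proved by this.
[cite: Stevens1982, Thm. 1.3.1 (cusps of X_Γ rational over ℚ(ζ_N); τ_d[x;y] = [x;d′y])] [cite: ConradEdixhovenStein2003, §6.1.2 Lemma 6.1.6 and §6.2;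
Thm. 1.1.3] [cite: Manin1972, §1.5–1.7, Thm. 3.5, Cor. 3.6] [cite: Stevens1989, Thm. 1.9 and §2] [cite: Vatsal2005, Rem. 1.8 (Shimura cover E₁ → E₀,
constant kernel)] [cite: DiamondShurman2005, Prop. 3.8.3 (cusps of Γ₁(N))] [cite: Cremona1997Algorithms, §2.6]

LANDING NOTE (prover p3 g17, T-an-54): an g41's file sha16 ef981588acbaadc4 VERBATIM except — the two helper lemmas `gamma1Uniformize_eq_zero_iff` / `cast_c_ne_zero_of_latticeOptimal'` restated landed declarations (gate `dedup.landed`) and are replaced by the tree's `gamma1_uniformize_eq_zero_iff` (`…ShimuraQuotientRational`) / `cast_c_ne_zero_of_latticeOptimal` (`…UDCLineKAtNine`), whose modules are now imported; nothing else changed.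
-/

set_option autoImplicit false
-- lint-debt: the directory name repeats the summit name (sibling precedent `ManinLocalTwoThreeShimuraThreeTorsionAtNine.lean`)
set_option linter.dupNamespace false

open scoped Classical MatrixGroups ModularForm
open CongruenceSubgroup WeierstrassCurve Literature.NumberTheory.EllipticCurves Literature.NumberTheory.EllipticCurves.ModularForms
open Summit.BirchSwinnertonDyer.Rank1Residual.ManinAdditive.KatoCurve

namespace Summit.BirchSwinnertonDyer.BirchSwinnertonDyer.Theorems.ManinLocalTwoThree.CuspGalois

/-! ### §0. The printed fact F♮ as a hypothesis binder
F♮ (PRINTED — Stevens 1982 Thm. 1.3.1, CES 2003 §6.1.2, Manin 1972; to be homed in Literature as `optimalGamma1Parametrization_cuspZero_galoisConjugate`,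
typer request T-an-53, SAME TEXT): for an OPTIMAL `X₁(N)`-datum `D` of `W` (`Λ_E = c·Λ₁(f)`) and `γ ∈ Γ₀(N)`, some `σ ∈ Aut(ℂ/ℚ)` carries
`φ(0) = D.uniformize (c{∞,0}_f)` to `φ(γ0) = D.uniformize (c({∞,0}_f + {∞,γ∞}_f))`.  It enters every theorem below as the explicit hypothesis `hB`
(a section variable; no definition is introduced in this Theorems file). -/

section CuspGaloisFacts

variable (hB : ∀ (W : WeierstrassCurve ℚ) [W.IsElliptic] {N : ℕ} [NeZero N] (D : Gamma1ParametrizationData W N),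
    D.IsOptimal → ∀ γ : Gamma0 N, ∃ σ : ℂ ≃ₐ[ℚ] ℂ,
      Affine.Point.map (W' := W) (σ : ℂ →ₐ[ℚ] ℂ) (D.uniformize ((D.c : ℂ) * modularSymbol D.f 0)) =
        D.uniformize ((D.c : ℂ) * (modularSymbol D.f 0 + cuspSymbol D.f γ)))

/-! ### §1. Elementary lemmas on an `X₁(N)`-datum -/

section Gamma1

variable {W : WeierstrassCurve ℚ} {N : ℕ} [NeZero N]

/-- `c ≠ 0` for an optimal `X₁(N)`-datum (`ω₁ = c·w` and `ω₁ ≠ 0`). [folklore] -/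
theorem gamma1_cast_c_ne_zero_of_isOptimal (D : Gamma1ParametrizationData W N) (hD : D.IsOptimal) : (D.c : ℂ) ≠ 0 := by
  intro hc
  obtain ⟨w, -, hw⟩ := hD D.L.ω₁ D.L.ω₁_mem_lattice
  rw [hc, zero_mul] at hw
  have hω : D.L.ω₁ ≠ 0 := by simpa using D.L.indep.ne_zero 0
  exact hω hw

/-- For an optimal `X₁(N)`-datum: `c·z ∈ Λ_E` iff `z ∈ Λ₁(f)`. [folklore] -/
theorem c_mul_mem_lattice_iff_of_isOptimal (D : Gamma1ParametrizationData W N) (hD : D.IsOptimal) (z : ℂ) :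
    (D.c : ℂ) * z ∈ D.L.lattice ↔ z ∈ periodLatticeGamma1 D.f := by
  constructor
  · intro h
    obtain ⟨w, hw, hw'⟩ := hD _ h
    have hc := gamma1_cast_c_ne_zero_of_isOptimal D hD
    rwa [mul_left_cancel₀ hc hw']
  · intro h
    exact D.smul_periodLatticeGamma1_le _ h

variable [W.IsElliptic]

/-- **Rational points are Galois-fixed**: for an optimal `X₁(N)`-datum `D` of `W`, every transported `Γ₀(N)`-period `D.uniformize (c w)`, `w ∈ Λ₀(f)`,
is the base change of a point of `W(ℚ)` (F★ + `coe_periodLattice_eq_range`), hence fixed by `Point.map σ` for every `ℚ`-algebra map `σ : ℂ → ℂ`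
(`Affine.Point.map_baseChange`). [cite: ConradEdixhovenStein2003, §6.1.2 and §6.2] -/
theorem map_uniformize_eq_self_of_mem_periodLattice (hF : optimalGamma1Parametrization_cusp_rational)
    (D : Gamma1ParametrizationData W N) (hD : D.IsOptimal) (σ : ℂ →ₐ[ℚ] ℂ) {w : ℂ} (hw : w ∈ periodLattice D.f) :
    Affine.Point.map (W' := W) σ (D.uniformize ((D.c : ℂ) * w)) = D.uniformize ((D.c : ℂ) * w) := by
  have hw' : w ∈ (periodLattice D.f : Set ℂ) := hw
  rw [coe_periodLattice_eq_range] at hw'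
  obtain ⟨γ, rfl⟩ := hw'
  obtain ⟨P, hP⟩ := hF W D hD γ
  rw [← hP, Affine.Point.map_baseChange]

end Gamma1

/-! ### §2. Θ for an optimal `X₁(N)`-datum: the order of `φ₁(0)` modulo rational points kills `Λ₀/Λ₁` -/

section Core

variable {W : WeierstrassCurve ℚ} [W.IsElliptic] {N : ℕ} [NeZero N]

include hB in
/-- **Θ (es's E-es-80) on an optimal `X₁(N)`-datum — PROVED from F★ ∧ F♮.**  If `m·{∞,0}_f ∈ Λ₀(f)` then `m·Λ₀(f) ⊆ Λ₁(f)`.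
Proof: `m•φ₁(0)` is rational, hence `σ`-fixed; `σ(φ₁(0)) = φ₁(0) + D.uniformize (c{∞,γ∞}_f)` (F♮); so `m • D.uniformize (c{∞,γ∞}_f) = 0`, i.e.
`m{∞,γ∞}_f ∈ Λ₁(f)`; and every element of `Λ₀(f)` is a `{∞,γ∞}_f`. [cite: Stevens1982, Thm. 1.3.1] [cite: Stevens1989, §2] -/
theorem periodLattice_mul_mem_periodLatticeGamma1_of_isOptimal (hF : optimalGamma1Parametrization_cusp_rational)
    (D : Gamma1ParametrizationData W N) (hD : D.IsOptimal) (m : ℕ) (hm : (m : ℂ) * modularSymbol D.f 0 ∈ periodLattice D.f) :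
    ∀ x ∈ periodLattice D.f, (m : ℂ) * x ∈ periodLatticeGamma1 D.f := by
  intro x hx
  have hx' : x ∈ (periodLattice D.f : Set ℂ) := hx
  rw [coe_periodLattice_eq_range] at hx'
  obtain ⟨γ, rfl⟩ := hx'
  obtain ⟨σ, hσ⟩ := hB W D hD γ
  -- `m • φ₁(0) = D.uniformize (c · m{∞,0}_f)` is rational, hence `σ`-fixed
  have hmQ : m • D.uniformize ((D.c : ℂ) * modularSymbol D.f 0) = D.uniformize ((D.c : ℂ) * ((m : ℂ) * modularSymbol D.f 0)) := by
    rw [← map_nsmul, nsmul_eq_mul]; congr 1; ring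
  have hfix : Affine.Point.map (W' := W) (σ : ℂ →ₐ[ℚ] ℂ) (m • D.uniformize ((D.c : ℂ) * modularSymbol D.f 0)) =
      m • D.uniformize ((D.c : ℂ) * modularSymbol D.f 0) := by
    rw [hmQ]; exact map_uniformize_eq_self_of_mem_periodLattice hF D hD _ hm
  -- and `σ(m•φ₁(0)) = m•φ₁(0) + m • D.uniformize (c{∞,γ∞}_f)` by F♮
  rw [map_nsmul, hσ, mul_add, map_add, smul_add, add_eq_left, ← map_nsmul, nsmul_eq_mul,
    gamma1_uniformize_eq_zero_iff, show (m : ℂ) * ((D.c : ℂ) * cuspSymbol D.f γ) = (D.c : ℂ) * ((m : ℂ) * cuspSymbol D.f γ) by ring,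
    c_mul_mem_lattice_iff_of_isOptimal D hD] at hfix
  exact hfix

end Core

/-! ### §3. Transport to a lattice-optimal `X₀(N)`-datum of a minimal curve (CES: an isogenous `X₁(N)`-optimal curve with the same newform) -/

section Transport

variable {W : WeierstrassCurve ℚ} [W.IsElliptic] [W.IsGloballyMinimal] {N : ℕ} [NeZero N]

include hB in
/-- **Θ on the stratum used by C3** (lattice-optimal `X₀(N)`-datum `D` of a globally minimal `W`): `m{∞,0}_f ∈ Λ₀(f) ⟹ m·Λ₀(f) ⊆ Λ₁(f)`,
from F★ ∧ F♮ ∧ CES.  (The statement only depends on `f = D.f`; CES supplies an isogenous `W₁` with an optimal `X₁(N)`-datum `D₁`, and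
`D₁.f = D.f` by multiplicity one since isogenous curves have the same `L`-coefficients.) [cite: ConradEdixhovenStein2003, Thm. 1.1.3] -/
theorem cuspZeroAnnihilates_of_latticeOptimal (hF : optimalGamma1Parametrization_cusp_rational) (hex : exists_optimal_gamma1ParametrizationData)
    (D : ModularParametrizationData W N) (hopt : ∀ z ∈ D.L.lattice, ∃ w ∈ periodLattice D.f, z = D.c * w)
    (m : ℕ) (hm : (m : ℂ) * modularSymbol D.f 0 ∈ periodLattice D.f) :
    ∀ x ∈ periodLattice D.f, (m : ℂ) * x ∈ periodLatticeGamma1 D.f := by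
  obtain ⟨W₁, _, _, D₁, hiso, hD₁⟩ := hex W D hopt
  have hf : D₁.f = D.f := eq_of_forall_cuspCoeff_eq_gamma0 fun n ↦ by
    rw [D₁.isNewformOf.2 n, (IsNewformOf.of_isIsogenous D.isNewformOf hiso).2 n]
  rw [← hf] at hm ⊢
  exact periodLattice_mul_mem_periodLatticeGamma1_of_isOptimal hB hF D₁ hD₁ m hm

end Transport

/-! ### §4. The an cusp-lifting laws E-an-128 / 128ℓ / 128₄ / 128₂ from F★₀ ∧ F★ ∧ F♮ ∧ CES (PROVED edges; an g40 FILE A's glue with Θ|opt in place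
of E-es-80) -/

section Glue

variable {W : WeierstrassCurve ℚ} [W.IsElliptic] [W.IsGloballyMinimal] {N : ℕ} [NeZero N]

omit [W.IsElliptic] [W.IsGloballyMinimal] in
/-- For a lattice-optimal datum, `n·φ(0) = O` in `E(ℂ)` iff `n·{∞,0}_f ∈ Λ₀(f)`. [folklore] -/
theorem nsmul_uniformize_cuspZero_eq_zero_iff' (D : ModularParametrizationData W N)
    (hopt : ∀ z ∈ D.L.lattice, ∃ w ∈ periodLattice D.f, z = D.c * w) (n : ℕ) :
    n • D.uniformize ((D.c : ℂ) * modularSymbol D.f 0) = 0 ↔ (n : ℂ) * modularSymbol D.f 0 ∈ periodLattice D.f := by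
  rw [← map_nsmul, D.uniformize_eq_zero_iff, nsmul_eq_mul]
  constructor
  · intro h
    obtain ⟨w, hw, hw'⟩ := hopt _ h
    have hc := cast_c_ne_zero_of_latticeOptimal D hopt
    have : (n : ℂ) * modularSymbol D.f 0 = w := by
      apply mul_left_cancel₀ hc
      rw [← hw']; ring
    rwa [this]
  · intro h
    have := D.smul_periodLattice_le _ h
    convert this using 1; ring

include hB in
/-- **The glue.**  F★₀ ∧ F★ ∧ F♮ ∧ CES ⟹ a Shimura `ℓᵏ`-kernel (`x ∈ Λ₀`, `ℓᵏx ∈ Λ₁`, `ℓᵏ⁻¹x ∉ Λ₁`) on a lattice-optimal minimal `W` forces a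
RATIONAL point of order exactly `ℓᵏ` — every prime `ℓ`, every `k ≥ 1`.  (`P ∈ W(ℚ)` maps to `φ(0)`; `n = ord P` is finite by Manin–Drinfeld;
`n{∞,0}_f ∈ Λ₀` so `n` kills `Λ₀/Λ₁` by §3; Bézout gives `ℓᵏ ∣ n`; `(n/ℓᵏ)•P` has order `ℓᵏ`.) [folklore] -/
theorem exists_addOrderOf_eq_primePow_of_cuspGalois (hF₀ : optimalParametrization_cuspZero_rational)
    (hF : optimalGamma1Parametrization_cusp_rational) (hex : exists_optimal_gamma1ParametrizationData)
    (D : ModularParametrizationData W N) (hopt : ∀ z ∈ D.L.lattice, ∃ w ∈ periodLattice D.f, z = D.c * w)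
    {ℓ k : ℕ} (hℓ : ℓ.Prime) (hk : 1 ≤ k)
    (hx : ∃ x ∈ periodLattice D.f, ((ℓ ^ k : ℕ) : ℂ) * x ∈ periodLatticeGamma1 D.f ∧
      ((ℓ ^ (k - 1) : ℕ) : ℂ) * x ∉ periodLatticeGamma1 D.f) :
    ∃ Q : W.toAffine.Point, addOrderOf Q = ℓ ^ k := by
  obtain ⟨P, hP⟩ := hF₀ W D hopt
  obtain ⟨x, hxΛ, hℓk, hℓk1⟩ := hx
  -- `φ(0)` is torsion (Manin–Drinfeld, tree theorem), hence so is `P` (the base-change map is injective)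
  set ι := Affine.Point.baseChange (W' := W) ℚ ℂ with hι
  have hιinj : Function.Injective ι := Affine.Point.map_injective _
  have hordP : addOrderOf (ι P) = addOrderOf P := addOrderOf_injective ι hιinj P
  obtain ⟨m, hm, hmΛ⟩ := exists_nsmul_modularSymbol_mem_periodLattice_of_isNewform0
    D.isNewformOf.1 D.isNewformOf.coeffField_eq_bot 0
  have hmP : m • ι P = 0 := by
    rw [hP, nsmul_uniformize_cuspZero_eq_zero_iff' D hopt]
    rwa [nsmul_eq_mul] at hmΛ
  have hfin : IsOfFinAddOrder (ι P) := isOfFinAddOrder_iff_nsmul_eq_zero.mpr ⟨m, hm, hmP⟩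
  set n := addOrderOf (ι P) with hn
  have hn0 : n ≠ 0 := (hfin.addOrderOf_pos).ne'
  -- `n·{∞,0}_f ∈ Λ₀`, so `n` kills `Λ₀/Λ₁` (Θ, §3)
  have hnΛ : (n : ℂ) * modularSymbol D.f 0 ∈ periodLattice D.f := by
    rw [← nsmul_uniformize_cuspZero_eq_zero_iff' D hopt, ← hP]
    exact addOrderOf_nsmul_eq_zero (ι P)
  have hnx : (n : ℂ) * x ∈ periodLatticeGamma1 D.f := cuspZeroAnnihilates_of_latticeOptimal hB hF hex D hopt n hnΛ x hxΛ
  -- hence `ℓᵏ ∣ n`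
  have hdvd : ℓ ^ k ∣ n := by
    have hg : ((Nat.gcd n (ℓ ^ k) : ℕ) : ℂ) * x ∈ periodLatticeGamma1 D.f := gcd_mul_mem hnx hℓk
    obtain ⟨j, hjk, hj⟩ := (Nat.dvd_prime_pow hℓ).1 (Nat.gcd_dvd_right n (ℓ ^ k))
    rcases hjk.lt_or_eq with hlt | heq
    · exfalso
      apply hℓk1
      have hsplit : ℓ ^ (k - 1) = ℓ ^ (k - 1 - j) * ℓ ^ j := by
        rw [← pow_add]; congr 1; omega
      rw [hsplit, Nat.cast_mul, mul_assoc, ← hj]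
      exact natCast_mul_mem hg _
    · rw [← heq, ← hj]; exact Nat.gcd_dvd_left n (ℓ ^ k)
  -- the rational point `(n/ℓᵏ)·P` has order exactly `ℓᵏ`
  have hq0 : n / ℓ ^ k ≠ 0 := (Nat.div_pos (Nat.le_of_dvd (Nat.pos_of_ne_zero hn0) hdvd) (pow_pos hℓ.pos k)).ne'
  have hordQ : addOrderOf ((n / ℓ ^ k) • P) = ℓ ^ k := by
    rw [addOrderOf_nsmul_of_dvd hq0 (hordP ▸ Nat.div_dvd_of_dvd hdvd), ← hordP, Nat.div_div_self hdvd hn0]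
  exact ⟨(n / ℓ ^ k) • P, hordQ⟩

include hB in
/-- The `k = 1` case: a Shimura `ℓ`-kernel (`¬ ShimuraIndexPrimeTo ℓ f`) forces a rational point of order `ℓ`. [folklore] -/
theorem exists_addOrderOf_eq_prime_of_cuspGalois (hF₀ : optimalParametrization_cuspZero_rational)
    (hF : optimalGamma1Parametrization_cusp_rational) (hex : exists_optimal_gamma1ParametrizationData)
    (D : ModularParametrizationData W N) (hopt : ∀ z ∈ D.L.lattice, ∃ w ∈ periodLattice D.f, z = D.c * w)
    {ℓ : ℕ} (hℓ : ℓ.Prime) (hS : ¬ ShimuraIndexPrimeTo ℓ D.f) :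
    ∃ Q : W.toAffine.Point, addOrderOf Q = ℓ := by
  have hx : ∃ x ∈ periodLattice D.f, ((ℓ ^ 1 : ℕ) : ℂ) * x ∈ periodLatticeGamma1 D.f ∧
      ((ℓ ^ (1 - 1) : ℕ) : ℂ) * x ∉ periodLatticeGamma1 D.f := by
    simp only [ShimuraIndexPrimeTo, not_forall, exists_prop] at hS
    obtain ⟨x, hx, hℓx, hxn⟩ := hS
    exact ⟨x, hx, by simpa using hℓx, by simpa using hxn⟩
  simpa using exists_addOrderOf_eq_primePow_of_cuspGalois hB hF₀ hF hex D hopt hℓ le_rfl hx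

end Glue

/-! ### §5. E-an-128 / 128ℓ / 128₄ / 128₂ ⟸ F★₀ ∧ F★ ∧ F♮ ∧ CES, by name -/

include hB in
/-- **E-an-128 ⟸ F★₀ ∧ F★ ∧ F♮ ∧ CES** (the `ℓ = 3` law on the short model, via LEAD's dictionary `exists_isShortThreeTorsion_of_addOrderOf_eq_three`). -/
theorem shimuraThreeForcesRationalThreeTorsion_of_cuspGalois (hF₀ : optimalParametrization_cuspZero_rational)
    (hF : optimalGamma1Parametrization_cusp_rational) (hex : exists_optimal_gamma1ParametrizationData) :
    ShimuraThreeForcesRationalThreeTorsion := by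
  intro W _ _ N _ D hopt hS
  obtain ⟨Q, hQ⟩ := exists_addOrderOf_eq_prime_of_cuspGalois hB hF₀ hF hex D hopt Nat.prime_three hS
  have hc : D.c ≠ 0 := fun h ↦ cast_c_ne_zero_of_latticeOptimal D hopt (by rw [h]; simp)
  exact exists_isShortThreeTorsion_of_addOrderOf_eq_three W hc hQ

include hB in
/-- **E-an-128ℓ ⟸ F★₀ ∧ F★ ∧ F♮ ∧ CES.** -/
theorem shimuraOddPrimeForcesRationalTorsion_of_cuspGalois (hF₀ : optimalParametrization_cuspZero_rational)
    (hF : optimalGamma1Parametrization_cusp_rational) (hex : exists_optimal_gamma1ParametrizationData) :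
    ShimuraOddPrimeForcesRationalTorsion := by
  intro W _ _ N _ D ℓ hℓ _ hopt hS
  exact exists_addOrderOf_eq_prime_of_cuspGalois hB hF₀ hF hex D hopt hℓ hS

include hB in
/-- **E-an-128₄ ⟸ F★₀ ∧ F★ ∧ F♮ ∧ CES.** -/
theorem shimuraFourForcesRationalFourTorsion_of_cuspGalois (hF₀ : optimalParametrization_cuspZero_rational)
    (hF : optimalGamma1Parametrization_cusp_rational) (hex : exists_optimal_gamma1ParametrizationData) :
    ShimuraFourForcesRationalFourTorsion := by
  intro W _ _ N _ D hopt hx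
  have hx' : ∃ x ∈ periodLattice D.f, ((2 ^ 2 : ℕ) : ℂ) * x ∈ periodLatticeGamma1 D.f ∧
      ((2 ^ (2 - 1) : ℕ) : ℂ) * x ∉ periodLatticeGamma1 D.f := by
    obtain ⟨x, hx, h4, h2⟩ := hx
    exact ⟨x, hx, by norm_num [h4], by norm_num [h2]⟩
  simpa using exists_addOrderOf_eq_primePow_of_cuspGalois hB hF₀ hF hex D hopt Nat.prime_two (by norm_num) hx'

include hB in
/-- **E-an-128₂ ⟸ F★₀ ∧ F★ ∧ F♮ ∧ CES** (a rational point of order `2` is `(e, ·)` with `e` a root of the `2`-division cubic). -/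
theorem shimuraTwoForcesRationalTwoTorsion_of_cuspGalois (hF₀ : optimalParametrization_cuspZero_rational)
    (hF : optimalGamma1Parametrization_cusp_rational) (hex : exists_optimal_gamma1ParametrizationData) :
    ShimuraTwoForcesRationalTwoTorsion := by
  intro W _ _ N _ D hopt hS
  obtain ⟨Q, hQ⟩ := exists_addOrderOf_eq_prime_of_cuspGalois hB hF₀ hF hex D hopt Nat.prime_two hS
  have hQ0 : Q ≠ 0 := by
    intro h; rw [h, addOrderOf_zero] at hQ; norm_num at hQ
  rcases Q with _ | ⟨x, y, hxy⟩
  · exact (hQ0 rfl).elim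
  have hadd : (Affine.Point.some x y hxy : W.toAffine.Point) + Affine.Point.some x y hxy = 0 := by
    have h := addOrderOf_nsmul_eq_zero (Affine.Point.some x y hxy : W.toAffine.Point)
    rw [hQ, two_nsmul] at h
    convert h using 2
  -- (`convert`: the tree lemma is stated with the classical `DecidableEq ℚ` instance inside `Affine.Point.instAdd`)
  obtain ⟨-, hroot⟩ := isRoot_twoTorsionPolynomial_of_add_self_eq_zero (W := W) (h := hxy) (by convert hadd using 6)
  exact ⟨x, hroot⟩

end CuspGaloisFacts

end Summit.BirchSwinnertonDyer.BirchSwinnertonDyer.Theorems.ManinLocalTwoThree.CuspGalois
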